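import Mathlib
import HarnessLib
import Summits.ResolutionOfSingularities.ResolutionOfSingularities.Theorems.WildQuotientsWildQuotientResolutionToricExitTransfer
import Summits.ResolutionOfSingularities.ResolutionOfSingularities.Theorems.WildQuotientsWildQuotientResolutionToricExitCentre
import Summits.ResolutionOfSingularities.ResolutionOfSingularities.Theorems.WildQuotientsWildQuotientResolutionToricExitCover
import Summits.ResolutionOfSingularities.ResolutionOfSingularities.Theorems.WildQuotientsWildQuotientResolutionToricExitChartStable
import Summits.ResolutionOfSingularities.ResolutionOfSingularities.Theorems.WildQuotientsWildQuotientResolutionJordanThreeOrderP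
import Summits.ResolutionOfSingularities.ResolutionOfSingularities.Theorems.WildQuotientsWildQuotientResolutionJordanThreeLaw
import Summits.ResolutionOfSingularities.ResolutionOfSingularities.Theorems.WildQuotientsWildQuotientResolutionAffineQuotientData
import Summits.ResolutionOfSingularities.ResolutionOfSingularities.Theorems.WildQuotientsWildQuotientResolutionAffineQuotientEtale
import Summits.ResolutionOfSingularities.ResolutionOfSingularities.Theorems.WildQuotientsWildQuotientResolutionLinearSmallBlocksAlgebra
import Summits.ResolutionOfSingularities.ResolutionOfSingularities.Theorems.WildQuotientsWildQuotientResolutionFixedPointsRegular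
import Summits.ResolutionOfSingularities.ResolutionOfSingularities.Theorems.WildQuotientsGaloisQuotientStableCover
import Literature.AlgebraicGeometry.Resolution.BlowupPrincipalCharts
import Literature.AlgebraicGeometry.Resolution.BlowupsEquivariant
import Summits.ResolutionOfSingularities.ResolutionOfSingularities.Theorems.WildQuotientsWildQuotientResolutionFixedPointsGraded

/-!
# V3U-F: the J₃ toric exit, assembled modulo its last bricks
(crux stmt-ResolutionOfSingularities-15640 `WildQuotients.WildQuotientResolution`, line `Sketch`;
chain w45c programme V3U, `L/w45c/CHAIN.md` v5 §4 lead-1 row, CRUX-PLAN v5 §U; [OURS · L1 W4.5c] —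
NOT a statement of any manuscript.)

`ToricExit.jordanThree_hasResolution_of_bricks`: for the `J₃` datum (`σ x_a = x_a`,
`σ x_b = x_b + x_a`, `σ x_c = x_c + x_b`, passengers fixed) over a field of characteristic `p ≥ 3`,
`Spec k[x]^⟨σ⟩` has a resolution of singularities PROVIDED the three remaining bricks of the toric
exit hold for `V = Bl_{(x_a, x_b²)} 𝔸ⁿ` with the lifted action (`IsBlowup.liftAction`, hρ =
`ToricExit.idealSheaf_centre_comap`, p485686) and its two principal charts
`V[x_a] = blowupChart π Ĩ₂ ⊤ x_a`, `V[x_b²]` (Literature `BlowupPrincipalCharts`):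

* `Hregb`/`HneOb` — the points of the chart `V[x_b²]` have regular local rings, and the stable piece
  `⋂ g·V[x_b²]` is non-empty
  (stub-2 D2 `isRegularRing_chartRing_centre_b` + the chart dictionary);
* `Hdivb` — at every fixed point of `V[x_b²]` the stalk augmentation ideal of the lifted action is
  principal (`ToricExit.I2.isPrincipal_stalkAug_liftAction_of_mem`, p486940, + the chart
  dictionary `ToricExit.stalkMap_germ_mem_span_of_chart`, p488439);
* `HPa` — THE CONE BRICK: every blow-up of the quotient piece `V[x_a]/G` along the ideal sheaf of
  the image of the vertex locus `Ta = π⁻¹V(I₂) ∖ V[x_b²]` is regular (C0-equiv + stub-1 C2/C3 +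
  stub-2 D3 + stub-4 C4 `cone_affineBlowup_isRegular`).

Everything else is discharged here: the crux data of `𝔸ⁿ → 𝔸ⁿ/⟨σ⟩` (`AffineQuotient.*`, order `p`
by `JordanThree.card_zpowers_prime`, generic étaleness over `D(x_a)`), the model
(`ToricExit.centre_blowup_integral_proper_birational`), the `G`-stability of `V[x_a]`
(`ToricExit.preimage_blowupChart_eq_self_of_action`, p488231, since `σ x_a = x_a`), the stable
affine piece `Ob = ⋂ g·V[x_b²]` (`ToricExit.exists_stable_affine_cover_pair`, p487610), the cover
`V[x_a] ∪ V[x_b²] = V` (`IsBlowup.iSup_blowupChart`), the topology of `Ta`, and the two-piece exit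
`ToricExit.toricExitTransfer` (p487969).
-/

-- single-problem summit: the doubled namespace component `ResolutionOfSingularities` is forced
set_option linter.dupNamespace false

noncomputable section

open CategoryTheory AlgebraicGeometry TopologicalSpace MvPolynomial
open Literature.AlgebraicGeometry.Resolution Literature.AlgebraicGeometry.RelativeSpec

namespace Summit.ResolutionOfSingularities.ResolutionOfSingularities.Theorems.WildQuotientResolution.ToricExit

-- the glued-quotient / blow-up bookkeeping is individually cheap but numerous
set_option maxHeartbeats 1600000 in
/-- **The J₃ toric exit modulo its last bricks** (see the module docstring for the bricks
`Hregb`, `HneOb`, `Hdivb`, `HPa`). [OURS · L1 W4.5c] [folklore; assembly of landed decls] -/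
theorem jordanThree_hasResolution_of_bricks (p : ℕ) (hp : p.Prime) (hp3 : 3 ≤ p)
    (k : Type) [Field k] [CharP k p] (n : ℕ)
    (σ : MvPolynomial (Fin n) k ≃ₐ[k] MvPolynomial (Fin n) k) [Finite ↥(Subgroup.zpowers σ)]
    (a b c : Fin n) (hab : a ≠ b) (_hbc : b ≠ c) (hac : a ≠ c)
    (hb : σ (X b) = X b + X a) (hc : σ (X c) = X c + X b)
    (hσ : ∀ i, i ≠ b → i ≠ c → σ (X i) = X i)
    (Hregb : ∀ v ∈ blowupChart
        (affineBlowup.π (Ideal.span (Set.range (![X a, X b ^ 2] : Fin 2 → MvPolynomial (Fin n) k))))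
        (affineBlowup.idealSheaf (Ideal.span (Set.range (![X a, X b ^ 2] :
          Fin 2 → MvPolynomial (Fin n) k))))
        ⟨⊤, isAffineOpen_top _⟩
        ((Scheme.ΓSpecIso (CommRingCat.of (MvPolynomial (Fin n) k))).inv.hom (X b ^ 2)),
      IsRegularLocalRing ((affineBlowup (Ideal.span (Set.range (![X a, X b ^ 2] :
        Fin 2 → MvPolynomial (Fin n) k)))).presheaf.stalk v))
    (HneOb : ∀ (ρ : ↥(Subgroup.zpowers σ) →* Aut (Spec (CommRingCat.of (MvPolynomial (Fin n) k))))
      (hρ : ∀ g : ↥(Subgroup.zpowers σ), (ρ g).hom = Spec.map (CommRingCat.ofHom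
        ((MulSemiringAction.toRingEquiv (↥(Subgroup.zpowers σ)) (MvPolynomial (Fin n) k) g⁻¹ :
          MvPolynomial (Fin n) k ≃+* MvPolynomial (Fin n) k) :
            MvPolynomial (Fin n) k →+* MvPolynomial (Fin n) k))),
      (((⨅ g : ↥(Subgroup.zpowers σ),
          (((affineBlowup.isBlowup (Ideal.span (Set.range (![X a, X b ^ 2] :
            Fin 2 → MvPolynomial (Fin n) k)))).liftAction ρ
            (idealSheaf_centre_comap k n σ a b c hab hac hb hσ ρ hρ)) g).hom ⁻¹ᵁ
          blowupChart
            (affineBlowup.π (Ideal.span (Set.range (![X a, X b ^ 2] :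
              Fin 2 → MvPolynomial (Fin n) k))))
            (affineBlowup.idealSheaf (Ideal.span (Set.range (![X a, X b ^ 2] :
              Fin 2 → MvPolynomial (Fin n) k))))
            ⟨⊤, isAffineOpen_top _⟩
            ((Scheme.ΓSpecIso (CommRingCat.of (MvPolynomial (Fin n) k))).inv.hom (X b ^ 2)) :
          (affineBlowup (Ideal.span (Set.range (![X a, X b ^ 2] :
            Fin 2 → MvPolynomial (Fin n) k)))).Opens)) :
        Set (affineBlowup (Ideal.span (Set.range (![X a, X b ^ 2] :
          Fin 2 → MvPolynomial (Fin n) k))))).Nonempty)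
    (Hdivb : ∀ (ρ : ↥(Subgroup.zpowers σ) →* Aut (Spec (CommRingCat.of (MvPolynomial (Fin n) k))))
      (hρ : ∀ g : ↥(Subgroup.zpowers σ), (ρ g).hom = Spec.map (CommRingCat.ofHom
        ((MulSemiringAction.toRingEquiv (↥(Subgroup.zpowers σ)) (MvPolynomial (Fin n) k) g⁻¹ :
          MvPolynomial (Fin n) k ≃+* MvPolynomial (Fin n) k) :
            MvPolynomial (Fin n) k →+* MvPolynomial (Fin n) k)))
      (g : ↥(Subgroup.zpowers σ))
      (v : affineBlowup (Ideal.span (Set.range (![X a, X b ^ 2] :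
        Fin 2 → MvPolynomial (Fin n) k))))
      (hv : (((affineBlowup.isBlowup (Ideal.span (Set.range (![X a, X b ^ 2] :
          Fin 2 → MvPolynomial (Fin n) k)))).liftAction ρ
          (idealSheaf_centre_comap k n σ a b c hab hac hb hσ ρ hρ)) g).hom.base v = v),
      v ∈ blowupChart
        (affineBlowup.π (Ideal.span (Set.range (![X a, X b ^ 2] : Fin 2 → MvPolynomial (Fin n) k))))
        (affineBlowup.idealSheaf (Ideal.span (Set.range (![X a, X b ^ 2] :
          Fin 2 → MvPolynomial (Fin n) k))))
        ⟨⊤, isAffineOpen_top _⟩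
        ((Scheme.ΓSpecIso (CommRingCat.of (MvPolynomial (Fin n) k))).inv.hom (X b ^ 2)) →
      (Ideal.span (Set.range fun s =>
        ((affineBlowup (Ideal.span (Set.range (![X a, X b ^ 2] :
          Fin 2 → MvPolynomial (Fin n) k)))).presheaf.stalkSpecializes (specializes_of_eq hv) ≫
          (((affineBlowup.isBlowup (Ideal.span (Set.range (![X a, X b ^ 2] :
            Fin 2 → MvPolynomial (Fin n) k)))).liftAction ρ
            (idealSheaf_centre_comap k n σ a b c hab hac hb hσ ρ hρ)) g).hom.stalkMap v).hom s -
            s)).IsPrincipal)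
    (HPa : ∀ (ρ : ↥(Subgroup.zpowers σ) →* Aut (Spec (CommRingCat.of (MvPolynomial (Fin n) k))))
      (hρ : ∀ g : ↥(Subgroup.zpowers σ), (ρ g).hom = Spec.map (CommRingCat.ofHom
        ((MulSemiringAction.toRingEquiv (↥(Subgroup.zpowers σ)) (MvPolynomial (Fin n) k) g⁻¹ :
          MvPolynomial (Fin n) k ≃+* MvPolynomial (Fin n) k) :
            MvPolynomial (Fin n) k →+* MvPolynomial (Fin n) k)))
      (ρB : ActionOver
        (affineBlowup.π (Ideal.span (Set.range (![X a, X b ^ 2] :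
          Fin 2 → MvPolynomial (Fin n) k))) ≫
          Spec.map (CommRingCat.ofHom (algebraMap
            (FixedPoints.subalgebra k (MvPolynomial (Fin n) k) (Subgroup.zpowers σ))
            (MvPolynomial (Fin n) k))))
        ↥(Subgroup.zpowers σ))
      (_ : ρB.aut = (affineBlowup.isBlowup (Ideal.span (Set.range (![X a, X b ^ 2] :
          Fin 2 → MvPolynomial (Fin n) k)))).liftAction ρ
          (idealSheaf_centre_comap k n σ a b c hab hac hb hσ ρ hρ))
      (Oa : ρB.StableAffineOpens)
      (_ : Oa.1 = blowupChart
        (affineBlowup.π (Ideal.span (Set.range (![X a, X b ^ 2] : Fin 2 → MvPolynomial (Fin n) k))))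
        (affineBlowup.idealSheaf (Ideal.span (Set.range (![X a, X b ^ 2] :
          Fin 2 → MvPolynomial (Fin n) k))))
        ⟨⊤, isAffineOpen_top _⟩
        ((Scheme.ΓSpecIso (CommRingCat.of (MvPolynomial (Fin n) k))).inv.hom (X a)))
      (Za : Closeds (ρB.pieceQuot Oa)),
      (Za : Set (ρB.pieceQuot Oa)) = (ρB.pieceMk Oa).base ''
        (Oa.1.ι.base ⁻¹'
          ({v | (affineBlowup.π (Ideal.span (Set.range (![X a, X b ^ 2] :
              Fin 2 → MvPolynomial (Fin n) k)))).base v ∈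
              PrimeSpectrum.zeroLocus (Ideal.span (Set.range (![X a, X b ^ 2] :
                Fin 2 → MvPolynomial (Fin n) k)) : Set (MvPolynomial (Fin n) k))} \
            (blowupChart
              (affineBlowup.π (Ideal.span (Set.range (![X a, X b ^ 2] :
                Fin 2 → MvPolynomial (Fin n) k))))
              (affineBlowup.idealSheaf (Ideal.span (Set.range (![X a, X b ^ 2] :
                Fin 2 → MvPolynomial (Fin n) k))))
              ⟨⊤, isAffineOpen_top _⟩
              ((Scheme.ΓSpecIso (CommRingCat.of (MvPolynomial (Fin n) k))).inv.hom (X b ^ 2)) :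
                Set _))) →
      ∀ (B' : Scheme.{0}) (pB : B' ⟶ ρB.pieceQuot Oa),
        IsBlowup pB (Scheme.IdealSheafData.vanishingIdeal Za) → Scheme.IsRegular B') :
    Scheme.HasResolution
      (Spec (.of (FixedPoints.subalgebra k (MvPolynomial (Fin n) k) (Subgroup.zpowers σ)))) := by
  classical
  haveI : Fact (Nat.Prime p) := ⟨hp⟩
  have hσp : σ ^ p = 1 := JordanThree.pow_prime_eq_one p hp hp3 k n σ a b c hab hac hb hc hσ
  have hcard : Nat.card (Subgroup.zpowers σ) = p :=
    JordanThree.card_zpowers_prime p hp hp3 k n σ a b c hab hac hb hc hσ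
  have ha : σ (X a) = X a := hσ a hab hac
  have hn : 0 < n := Fin.pos a
  -- the rings: `S = k[x]`, `G = ⟨σ⟩`, `A = S^G`
  let S : Type := MvPolynomial (Fin n) k
  let G : Type := ↥(Subgroup.zpowers σ)
  let A : Subalgebra k S := FixedPoints.subalgebra k S G
  -- the action on `𝔸ⁿ`
  obtain ⟨ρ, hρ⟩ := AffineQuotient.exists_specAction S G
  -- the quotient data
  let fk : Spec (.of A) ⟶ Spec (.of k) := Spec.map (CommRingCat.ofHom (algebraMap k A))
  let q : Spec (.of S) ⟶ Spec (.of A) := Spec.map (CommRingCat.ofHom (algebraMap A S))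
  haveI : LocallyOfFiniteType fk := AffineQuotient.locallyOfFiniteType_specMap_fixedPoints k
  haveI : IsFinite q := AffineQuotient.isFinite_specMap_fixedPoints k
  have hsurj : Function.Surjective q.base := AffineQuotient.surjective_specMap_fixedPoints k
  have hρq : ∀ g : G, (ρ g).hom ≫ q = q := AffineQuotient.specAction_comp k ρ hρ
  have horb : ∀ x y : Spec (CommRingCat.of S), q.base x = q.base y →
      ∃ g : G, (ρ g).hom.base x = y :=
    fun x y hxy => AffineQuotient.exists_specAction_base_eq k ρ hρ x y hxy
  -- faithfulness of `ρ`
  have hfaith : Function.Injective ρ := by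
    intro g h hgh
    have h1 : (ρ g).hom = (ρ h).hom := by rw [hgh]
    rw [hρ, hρ] at h1
    have h2 := Spec.map_injective h1
    have h3 : ∀ x : S, g⁻¹ • x = h⁻¹ • x := fun x => by
      have := congrArg (fun f : CommRingCat.of S ⟶ CommRingCat.of S => f.hom x) h2
      simpa using this
    have h4 : g⁻¹ = h⁻¹ := Subtype.ext (AlgEquiv.ext fun x => h3 x)
    exact inv_injective h4
  -- generically étale: over `D(x_a)`
  have hXa : (X a : S) ∈ A := (TameTransfer.mem_fixedPoints_zpowers_iff_apply_eq σ (X a)).mpr ha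
  have ht0 : (⟨X a, hXa⟩ : A) ≠ 0 := fun h =>
    MvPolynomial.X_ne_zero a (congrArg Subtype.val h : ((⟨X a, hXa⟩ : A) : S) = ((0 : A) : S))
  have hU : ∃ U : (Spec (.of A)).Opens, Dense (U : Set (Spec (.of A))) ∧ Etale (q ∣_ U) :=
    AffineQuotient.exists_dense_etale_morphismRestrict k (⟨X a, hXa⟩ : A) ht0
      fun g hg => LinearSmallBlocks.X_mem_augIdeal_of_transvection k p hp σ a b ha hb hσp g hg
  -- `dim X₁ = n > 0`
  have hdim : ¬ topologicalKrullDim (Spec (CommRingCat.of A)) ≤ 0 := by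
    rw [AffineQuotient.topologicalKrullDim_spec_fixedPoints k,
      AffineQuotient.topologicalKrullDim_spec_mvPolynomial k n]
    have hn' : (0 : WithBot ℕ∞) < (n : WithBot ℕ∞) := by exact_mod_cast hn
    exact not_le.mpr hn'
  -- the model `V = Bl_{(x_a, x_b²)} 𝔸ⁿ` with the lifted action
  let I₂ : Ideal S := Ideal.span (Set.range (![X a, X b ^ 2] : Fin 2 → S))
  have hπ : IsBlowup (affineBlowup.π I₂) (affineBlowup.idealSheaf I₂) := affineBlowup.isBlowup I₂
  obtain ⟨hVint, hVprop, hbir⟩ := centre_blowup_integral_proper_birational k n a b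
  have hJ : ∀ g : G, (affineBlowup.idealSheaf I₂).comap (ρ g).hom = affineBlowup.idealSheaf I₂ :=
    idealSheaf_centre_comap k n σ a b c hab hac hb hσ ρ hρ
  have hequiv : ∀ g : G, (hπ.liftAction ρ hJ g).hom ≫ affineBlowup.π I₂ =
      affineBlowup.π I₂ ≫ (ρ g).hom := fun g => hπ.liftAction_hom_comp ρ hJ g
  haveI : (Spec (CommRingCat.of A)).IsSeparated := inferInstance
  let ρB : ActionOver (affineBlowup.π I₂ ≫ q) G :=
    ⟨hπ.liftAction ρ hJ, fun g => by rw [← Category.assoc, hequiv g, Category.assoc, hρq g]⟩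
  -- the sections `x_a`, `x_b²` of `Γ(𝔸ⁿ, ⊤)` and the two principal charts
  let ι₀ : S →+* Γ(Spec (CommRingCat.of S), ⊤) := (Scheme.ΓSpecIso (CommRingCat.of S)).inv.hom
  have hIdeal : (affineBlowup.idealSheaf I₂).ideal ⟨⊤, isAffineOpen_top _⟩ = I₂.map ι₀ := by
    change (Scheme.IdealSheafData.ofIdealTop _).ideal ⟨⊤, isAffineOpen_top _⟩ = _
    rw [ideal_ofIdealTop_top]
  have hxa : ι₀ (X a) ∈ (affineBlowup.idealSheaf I₂).ideal ⟨⊤, isAffineOpen_top _⟩ := by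
    rw [hIdeal]; exact Ideal.mem_map_of_mem _ (Ideal.subset_span ⟨0, rfl⟩)
  have hxb : ι₀ (X b ^ 2) ∈ (affineBlowup.idealSheaf I₂).ideal ⟨⊤, isAffineOpen_top _⟩ := by
    rw [hIdeal]; exact Ideal.mem_map_of_mem _ (Ideal.subset_span ⟨1, rfl⟩)
  let chartA := blowupChart (affineBlowup.π I₂) (affineBlowup.idealSheaf I₂)
    ⟨⊤, isAffineOpen_top _⟩ (ι₀ (X a))
  let chartB := blowupChart (affineBlowup.π I₂) (affineBlowup.idealSheaf I₂)
    ⟨⊤, isAffineOpen_top _⟩ (ι₀ (X b ^ 2))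
  -- the charts cover `V`
  have hAB : chartA ⊔ chartB = ⊤ := by
    have hx : Ideal.span (Set.range (![ι₀ (X a), ι₀ (X b ^ 2)] :
        Fin 2 → Γ(Spec (CommRingCat.of S), ⊤))) =
        (affineBlowup.idealSheaf I₂).ideal ⟨⊤, isAffineOpen_top _⟩ := by
      rw [hIdeal, Ideal.map_span, ← Set.range_comp]
      congr 1
      ext y
      simp only [Set.mem_range, Function.comp_apply]
      constructor
      · rintro ⟨j, rfl⟩
        fin_cases j
        · exact ⟨0, rfl⟩
        · exact ⟨1, rfl⟩
      · rintro ⟨j, rfl⟩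
        fin_cases j
        · exact ⟨0, rfl⟩
        · exact ⟨1, rfl⟩
    have h := hπ.iSup_blowupChart (U := ⟨⊤, isAffineOpen_top _⟩) (![ι₀ (X a), ι₀ (X b ^ 2)]) hx
    rw [Scheme.Hom.preimage_top] at h
    rw [eq_top_iff, ← h]
    refine iSup_le fun j => ?_
    fin_cases j
    · exact le_sup_left
    · exact le_sup_right
  -- `V[x_a]` is `G`-stable (`σ x_a = x_a`)
  have hfin : IsOfFinOrder σ := isOfFinOrder_iff_pow_eq_one.mpr ⟨p, hp.pos, hσp⟩
  have hsmulXa : ∀ g : G, g • (X a : S) = X a := by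
    intro g
    obtain ⟨j, hj, hga, -, -, -⟩ := JordanThree.exists_pow_law k n σ a b c hab hac hb hc hσ hfin g
    exact hga
  have hA_st : ∀ g : G, (hπ.liftAction ρ hJ g).hom ⁻¹ᵁ chartA = chartA := fun g =>
    preimage_blowupChart_eq_self_of_action hπ ρ (hπ.liftAction ρ hJ) hequiv hJ hxa
      (fun g => specAction_appTop_ΓSpecIso_inv ρ hρ (X a) hsmulXa g) g
  -- the stable affine piece `Ob = ⋂ g·V[x_b²]`
  have hB_aff : IsAffineOpen chartB := hπ.isAffineOpen_blowupChart hxb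
  obtain ⟨hOb_aff, hOb_st, hOb_le, hcovab⟩ :=
    exists_stable_affine_cover_pair (hπ.liftAction ρ hJ) chartA chartB hA_st hB_aff hAB
  haveI : IsAffine (chartA : Scheme.{0}) := hπ.isAffineOpen_blowupChart hxa
  haveI : IsAffine ((⨅ g : G, (hπ.liftAction ρ hJ g).hom ⁻¹ᵁ chartB : (affineBlowup I₂).Opens) :
    Scheme.{0}) := hOb_aff
  let Oa : ρB.StableAffineOpens := ⟨chartA, hA_st, isAffineHom_of_isAffine_of_isSeparated _⟩
  let Ob : ρB.StableAffineOpens :=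
    ⟨⨅ g : G, (hπ.liftAction ρ hJ g).hom ⁻¹ᵁ chartB, hOb_st, isAffineHom_of_isAffine_of_isSeparated _⟩
  -- `Ob` is non-empty: it contains the generic point
  have hObne : ((Ob.1 : (affineBlowup I₂).Opens) : Set (affineBlowup I₂)).Nonempty :=
    HneOb ρ hρ
  -- piece `b` is regular
  have hregb : Scheme.IsRegular ((Ob.1 : (affineBlowup I₂).Opens) : Scheme.{0}) := fun y => by
    haveI : IsRegularLocalRing ((affineBlowup I₂).presheaf.stalk
        ((Ob.1 : (affineBlowup I₂).Opens).ι.base y)) := Hregb y.1 (hOb_le y.2)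
    exact IsRegularLocalRing.of_ringEquiv
      (asIso ((Ob.1 : (affineBlowup I₂).Opens).ι.stalkMap y)).commRingCatIsoToRingEquiv
  -- the vertex locus
  let Ta : Set (affineBlowup I₂) :=
    {v | (affineBlowup.π I₂).base v ∈ PrimeSpectrum.zeroLocus (I₂ : Set S)} \ (chartB : Set _)
  have hTa : IsClosed Ta :=
    ((PrimeSpectrum.isClosed_zeroLocus _).preimage (affineBlowup.π I₂).base.hom.continuous).sdiff
      chartB.isOpen
  have hTa1 : Ta ⊆ ((Oa.1 : (affineBlowup I₂).Opens) : Set (affineBlowup I₂)) := by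
    intro v hv
    have hv' : v ∈ chartA ⊔ chartB := by rw [hAB]; exact Opens.mem_top v
    rcases Opens.mem_sup.mp hv' with h | h
    · exact h
    · exact absurd h hv.2
  have hTa2 : Disjoint Ta ((Ob.1 : (affineBlowup I₂).Opens) : Set (affineBlowup I₂)) := by
    rw [Set.disjoint_left]
    intro v hv hvb
    exact hv.2 (hOb_le hvb)
  -- the exit
  exact toricExitTransfer p hp k (Spec (.of S)) (Spec (.of A)) fk q G ρ hcard hfaith hdim hsurj hU
    horb (affineBlowup I₂) (affineBlowup.π I₂) hbir ρB hequiv Oa Ob hcovab hObne hregb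
    (fun g v hv hvO => Hdivb ρ hρ g v hv (hOb_le hvO)) Ta hTa hTa1 hTa2
    (HPa ρ hρ ρB rfl Oa rfl)

end Summit.ResolutionOfSingularities.ResolutionOfSingularities.Theorems.WildQuotientResolution.ToricExit

end
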